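import Summits.KontsevichZagierPeriods.KontsevichZagierPeriods.Theorems.LinRedNormalFormHoffmanSpanInKZDerived

/-!
# Crux `LinRedNormalForm.HoffmanSpanInKZ` (stmt-KontsevichZagierPeriods-15044), line `Sketch`:
# a sparse radix zero test for the transcript checkers

The radix zero test `zeroTest n v` of `LinRedNormalFormHoffmanSpanInKZCertCheck` recurses into BOTH halves of
the split at every level, also below an empty combination, so that one call on words of length `N` always
visits the full binary tree of depth `N + 1` (`2^{N+1} − 1` calls — `4095` at weight `11` — however short
`v` is).  In the elimination-transcript tables of `LinRedNormalFormHoffmanSpanInKZDerived` most rows are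
short (a duality row has two words), and at weight `11` this fixed cost dominates the kernel time by two
orders of magnitude.  `zeroTest'` below stops at empty sub-combinations (so a combination with `k` terms
visits at most `k (N+1)` nodes); `drowOk'`, `dtableOk'`, `wrowOk'`, `wtableOk'` are the checkers of the
Derived file with this test, with the same soundness statements (`clause_of_dtableOk'`,
`clause_of_wtableOk'`, `edsCertificate_of_dwtables'`) and splitting lemmas.

Sources: the reflection set-up of `MzvKernelInKZTwoPosetsEdsCertificateLow`,
`LinRedNormalFormHoffmanSpanInKZCertCheck` and `LinRedNormalFormHoffmanSpanInKZDerived` (this tree). [folklore]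
-/

namespace Summit.KontsevichZagierPeriods.LinRedNormalForm.HoffmanSpanInKZ

open Literature.NumberTheory.Transcendental
open Summit.KontsevichZagierPeriods.MzvKernelInKZ.Negative
open Summit.KontsevichZagierPeriods.MzvKernelInKZ.TwoPosets

/-! ## The sparse radix zero test -/

/-- The radix zero test, stopping at empty sub-combinations: every word has total coefficient `0`
(fuel `n` = the common word length). [folklore] -/
def zeroTest' : ℕ → FVec → Bool
  | _, [] => true
  | 0, p :: v => decide ((splitFV (p :: v)).1 = 0) && (splitFV (p :: v)).2.1.isEmpty &&
      (splitFV (p :: v)).2.2.isEmpty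
  | n + 1, p :: v => decide ((splitFV (p :: v)).1 = 0) && zeroTest' n (splitFV (p :: v)).2.1 &&
      zeroTest' n (splitFV (p :: v)).2.2

/-- **Soundness of the sparse radix zero test** (prefix form). [folklore] -/
theorem evalP_eq_zero_of_zeroTest' (N : ℕ) :
    ∀ (n : ℕ) (pre : List Bool) (v : FVec), zeroTest' n v = true → evalP N pre v = 0 := by
  intro n
  induction n with
  | zero =>
    intro pre v h
    cases v with
    | nil => simp
    | cons p v =>
      simp only [zeroTest', Bool.and_eq_true, decide_eq_true_eq, List.isEmpty_iff] at h
      obtain ⟨⟨h0, h1⟩, h2⟩ := h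
      rw [evalP_split, h0, h1, h2]
      simp
  | succ n ih =>
    intro pre v h
    cases v with
    | nil => simp
    | cons p v =>
      simp only [zeroTest', Bool.and_eq_true, decide_eq_true_eq] at h
      obtain ⟨⟨h0, h1⟩, h2⟩ := h
      rw [evalP_split, h0, ih _ _ h1, ih _ _ h2]
      simp

/-- **Soundness of the sparse radix zero test**: if `zeroTest' n v` accepts, the realised vector vanishes.
[folklore] -/
theorem eval_eq_zero_of_zeroTest' (N : ℕ) {n : ℕ} {v : FVec} (h : zeroTest' n v = true) :
    FVec.eval N v = 0 := by
  rw [← evalP_nil]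
  exact evalP_eq_zero_of_zeroTest' N n [] v h

/-! ## The transcript checkers with the sparse test -/

/-- Derived-row checker with the sparse zero test. [folklore] -/
def drowOk' (N : ℕ) (mem : List FVec) (d : DRow) : Bool :=
  d.g.ok N && zeroTest' N (d.fvec N mem)

/-- Derived-table checker with the sparse zero test. [folklore] -/
def dtableOk' (N : ℕ) : List FVec → List DRow → Bool
  | _, [] => true
  | mem, d :: ds => drowOk' N mem d && dtableOk' N (mem ++ [d.vfvec]) ds

/-- Word-row checker with the sparse zero test. [folklore] -/
def wrowOk' (N : ℕ) (dv : List FVec) (prev : List (List ℕ)) (c : WRow) : Bool :=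
  decide (∀ p ∈ c.H, MZV.IsHoffman p.1 ∧ MZV.weight p.1 = N) &&
  c.P.all (fun p => prev.contains p.1) && zeroTest' N (c.fvec dv)

/-- Word-table checker with the sparse zero test. [folklore] -/
def wtableOk' (N : ℕ) (dv : List FVec) : List (List ℕ) → List WRow → Bool
  | _, [] => true
  | prev, c :: T => wrowOk' N dv prev c && wtableOk' N dv (c.w :: prev) T

section Soundness

variable {N : ℕ}

/-- Soundness of one derived row (sparse test). [folklore] -/
theorem clause_of_drowOk' (mem : List FVec) (hmem : ∀ v ∈ mem, Clause N (FVec.eval N v)) (d : DRow)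
    (h : drowOk' N mem d = true) : Clause N (FVec.eval N d.vfvec) := by
  simp only [drowOk', Bool.and_eq_true] at h
  obtain ⟨hg, hz⟩ := h
  have h0 := eval_eq_zero_of_zeroTest' N hz
  rw [DRow.fvec, FVec.eval_append, FVec.eval_append, FVec.eval_smul, neg_one_smul,
    ← sub_eq_add_neg, sub_eq_zero] at h0
  rw [← h0]
  exact clause_add (Gen.clause N d.g hg) (clause_eval_flatMap_mem mem hmem d.L qOf)

/-- Soundness of the derived-table checker (sparse test). [folklore] -/
theorem clause_of_dtableOk' :
    ∀ (T : List DRow) (mem : List FVec), (∀ v ∈ mem, Clause N (FVec.eval N v)) →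
      dtableOk' N mem T = true → ∀ v ∈ mem ++ T.map DRow.vfvec, Clause N (FVec.eval N v) := by
  intro T
  induction T with
  | nil => intro mem hmem _ v hv; simpa using hmem v (by simpa using hv)
  | cons d T ih =>
    intro mem hmem h v hv
    simp only [dtableOk', Bool.and_eq_true] at h
    obtain ⟨hd, hT⟩ := h
    have hdv : Clause N (FVec.eval N d.vfvec) := clause_of_drowOk' mem hmem d hd
    have hmem' : ∀ v ∈ mem ++ [d.vfvec], Clause N (FVec.eval N v) := by
      intro v hv
      rcases List.mem_append.1 hv with h' | h'
      · exact hmem v h'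
      · simp only [List.mem_singleton] at h'
        subst h'
        exact hdv
    refine ih (mem ++ [d.vfvec]) hmem' hT v ?_
    simpa [List.append_assoc] using hv

/-- Splitting a derived-table check at an append (sparse test). [folklore] -/
theorem dtableOk'_append (N : ℕ) :
    ∀ (A B : List DRow) (mem : List FVec), dtableOk' N mem A = true →
      dtableOk' N (mem ++ A.map DRow.vfvec) B = true → dtableOk' N mem (A ++ B) = true := by
  intro A
  induction A with
  | nil => intro B mem _ h; simpa using h
  | cons d A ih =>
    intro B mem h₁ h₂
    simp only [dtableOk', List.cons_append, Bool.and_eq_true] at h₁ ⊢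
    refine ⟨h₁.1, ih B (mem ++ [d.vfvec]) h₁.2 ?_⟩
    simpa [List.append_assoc] using h₂

/-- Soundness of one word row (sparse test). [folklore] -/
theorem clause_of_wrowOk' (dv : List FVec) (hdv : ∀ v ∈ dv, Clause N (FVec.eval N v))
    (prev : List (List ℕ)) (hprev : ∀ w ∈ prev, Clause N (unitVec N (bword N w))) (c : WRow)
    (h : wrowOk' N dv prev c = true) : Clause N (unitVec N (bword N c.w)) := by
  simp only [wrowOk', Bool.and_eq_true, decide_eq_true_eq, List.all_eq_true] at h
  obtain ⟨⟨hH, hP⟩, hz⟩ := h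
  have h0 := eval_eq_zero_of_zeroTest' N hz
  rw [WRow.fvec, FVec.eval_append, FVec.eval_cons, FVec.eval_append, eval_map_neg, eval_map_neg,
    eval_flatMap_neg, one_smul] at h0
  have h1 : unitVec N (bword N c.w) =
      (c.P.map fun p => qOf p.2 • unitVec N (bword N p.1)).sum +
        ((c.H.map fun p => qOf p.2 • unitVec N (bword N p.1)).sum +
          FVec.eval N (c.E.flatMap fun p => FVec.smul (qOf p.2) (dv.getD p.1 []))) := by
    rw [← sub_eq_zero, ← h0]
    simp only [bword]
    abel
  rw [h1]
  refine clause_add ?_ (clause_add ?_ (clause_eval_flatMap_mem dv hdv c.E qOf))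
  · have := clause_sum_refs (N := N) (c.P.map fun p => (p.1, qOf p.2)) fun p hp => by
      obtain ⟨p', hp', rfl⟩ := List.mem_map.1 hp
      exact hprev p'.1 (List.contains_iff_mem.1 (hP p' hp'))
    simpa [List.map_map, Function.comp_def] using this
  · have := clause_hoffman (N := N) (c.H.map fun p => (p.1, qOf p.2)) fun p hp => by
      obtain ⟨p', hp', rfl⟩ := List.mem_map.1 hp
      exact hH p' hp'
    simpa [List.map_map, Function.comp_def] using this

/-- Soundness of the word-table checker (sparse test). [folklore] -/
theorem clause_of_wtableOk' (dv : List FVec) (hdv : ∀ v ∈ dv, Clause N (FVec.eval N v)) :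
    ∀ (T : List WRow) (prev : List (List ℕ)), (∀ w ∈ prev, Clause N (unitVec N (bword N w))) →
      wtableOk' N dv prev T = true → ∀ c ∈ T, Clause N (unitVec N (bword N c.w)) := by
  intro T
  induction T with
  | nil => intro _ _ _ c hc; simp at hc
  | cons c T ih =>
    intro prev hprev h c' hc'
    simp only [wtableOk', Bool.and_eq_true] at h
    obtain ⟨hc, hT⟩ := h
    have hcw : Clause N (unitVec N (bword N c.w)) := clause_of_wrowOk' dv hdv prev hprev c hc
    rcases List.mem_cons.1 hc' with rfl | hmem
    · exact hcw
    · refine ih (c.w :: prev) ?_ hT c' hmem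
      intro w hw
      rcases List.mem_cons.1 hw with rfl | hw'
      exacts [hcw, hprev w hw']

/-- Splitting a word-table check at an append (sparse test). [folklore] -/
theorem wtableOk'_append (N : ℕ) (dv : List FVec) :
    ∀ (T₁ T₂ : List WRow) (prev : List (List ℕ)),
      wtableOk' N dv prev T₁ = true → wtableOk' N dv ((T₁.map WRow.w).reverse ++ prev) T₂ = true →
        wtableOk' N dv prev (T₁ ++ T₂) = true := by
  intro T₁
  induction T₁ with
  | nil => intro T₂ prev _ h; simpa using h
  | cons c T₁ ih =>
    intro T₂ prev h₁ h₂
    simp only [wtableOk', List.cons_append, Bool.and_eq_true] at h₁ ⊢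
    refine ⟨h₁.1, ih T₂ (c.w :: prev) h₁.2 ?_⟩
    simpa [List.map_cons, List.reverse_cons, List.append_assoc] using h₂

/-- **From checked tables (sparse test) to `EdsCertificate N`.** [folklore] -/
theorem edsCertificate_of_dwtables' (N : ℕ) (Δ : List DRow) (T : List WRow)
    (hΔ : dtableOk' N [] Δ = true) (hT : wtableOk' N (Δ.map DRow.vfvec) [] T = true)
    (hcover : ∀ ε : Fin N → Bool, Adm ε → ∃ c ∈ T, bword N c.w = ε) : EdsCertificate N := by
  have hdv : ∀ v ∈ Δ.map DRow.vfvec, Clause N (FVec.eval N v) := fun v hv =>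
    clause_of_dtableOk' Δ [] (fun v hv => by simp at hv) hΔ v (by simpa using hv)
  intro ε hε
  obtain ⟨c, hc, rfl⟩ := hcover ε hε
  exact clause_of_wtableOk' _ hdv T [] (fun w hw => by simp at hw) hT c hc

end Soundness

/-! ## The registered stub -/

/-- Soundness of the two-table format with the sparse zero test, as a statement about this file's own
checkers (not a published fact). -/
def DerivedFastSound : Prop :=
  ∀ (N : ℕ) (Δ : List DRow) (T : List WRow), dtableOk' N [] Δ = true →
    wtableOk' N (Δ.map DRow.vfvec) [] T = true →
      (∀ ε : Fin N → Bool, Adm ε → ∃ c ∈ T, bword N c.w = ε) → EdsCertificate N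

/-- **Registered stub `stub_derivedFast`** of the skeleton of line `Sketch` (infrastructure for the
weight-`11`/`12` tables). -/
theorem stub_derivedFast : DerivedFastSound := edsCertificate_of_dwtables'

/-- Smoke test (kernel), weight `4`, the tables of the Derived file's smoke test. -/
example : dtableOk' 4 []
    [⟨.F [2] [2], [], [([3, 1], 4, 1), ([4], -1, 1)]⟩,
     ⟨.D [3], [(0, 1, 4)], [([4], 3, 4), ([2, 2], -1, 1)]⟩,
     ⟨.K [2, 1, 1], [], [([2, 1, 1], 1, 1), ([4], -1, 1)]⟩] = true := by
  decide +kernel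

example : wtableOk' 4
    ([⟨.F [2] [2], [], [([3, 1], 4, 1), ([4], -1, 1)]⟩,
      ⟨.D [3], [(0, 1, 4)], [([4], 3, 4), ([2, 2], -1, 1)]⟩,
      ⟨.K [2, 1, 1], [], [([2, 1, 1], 1, 1), ([4], -1, 1)]⟩].map DRow.vfvec) []
    [⟨[2, 2], [], [([2, 2], 1, 1)], []⟩,
     ⟨[4], [], [([2, 2], 4, 3)], [(1, 4, 3)]⟩,
     ⟨[3, 1], [([4], 1, 4)], [], [(0, 1, 4)]⟩,
     ⟨[2, 1, 1], [([4], 1, 1)], [], [(2, 1, 1)]⟩] = true := by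
  decide +kernel

end Summit.KontsevichZagierPeriods.LinRedNormalForm.HoffmanSpanInKZ
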